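import Mathlib.FieldTheory.Separable
import Mathlib.Algebra.Polynomial.Eval.Coeff
import HarnessLib

/-!
# Separability of a polynomial over a finite product of rings is componentwise

Topic `Algebra/Polynomial`; namespace `Literature.Algebra.Polynomial`.  Theorems only (no definition, no named fact, no instance,
no `sorry`); Mathlib only.

For a finite product `R = Π_i R_i` of commutative rings and `p ∈ R[X]`: **`p` is separable (Mathlib: `IsCoprime p p′`) iff every
component `p_i ∈ R_i[X]` (the image under `Pi.evalRingHom R i`) is separable** — `separable_iff_forall_map_evalRingHom`.  (⇒) is
`Polynomial.Separable.map`; (⇐) assembles Bézout coefficients componentwise through the lifts `Σ_n C (Pi.single i c_n) Xⁿ`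
(`eq_of_forall_map_evalRingHom_eq`: a polynomial over `Π_i R_i` is determined by its components).

WHY (the use).  The tree's local rings at a finite place are the products `E ⊗_F F_v = Π_{w ∣ v} E_w` (★ `UnitaryGroup.LocalRing`), and
regularity (★ `Rogawski1990.IsRegularElt`: separable characteristic polynomial over that product) must be read place by place at a
SPLIT `v` (two places `w ≠ w̄`): with this lemma the `G`-regular locus of `H_v` is open at split places as it is at non-split ones
(★ `LocalEndoscopicChartDatumCM.isOpen_setOf_isLocalGRegular`) — input (d1) of the road «W1s soft Weyl» (P3b line, stub
`stub_weylVanishingSplit`).  Elementary commutative algebra: ideals ∕ Bézout identities in a finite product of rings are componentwise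
[Lang2002, Ch. II §5 (products of rings)].

## References
* [Lang2002] S. Lang, *Algebra*, rev. 3rd ed., GTM 211 (2002), Ch. II §5 (direct products of rings; componentwise ideals).
-/

set_option autoImplicit false

noncomputable section

open Polynomial

namespace Literature.Algebra.Polynomial

variable {ι : Type*} [Fintype ι] [DecidableEq ι] {R : ι → Type*} [∀ i, CommRing (R i)]

omit [Fintype ι] [DecidableEq ι] in
/-- A polynomial over `Π_i R_i` is determined by its components `p.map (Pi.evalRingHom R i)`. [cite: Lang2002, Ch. II §5] -/
theorem eq_of_forall_map_evalRingHom_eq {p q : (Π i, R i)[X]} (h : ∀ i, p.map (Pi.evalRingHom R i) = q.map (Pi.evalRingHom R i)) :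
    p = q := by
  ext n i
  have := congrArg (fun r => coeff r n) (h i)
  simpa only [coeff_map, Pi.evalRingHom_apply] using this

omit [Fintype ι] in
/-- The lift `Σ_n C (single_i c_n) Xⁿ` of `q ∈ R_i[X]` to `(Π_i R_i)[X]` has `i`-component `q`. [cite: Lang2002, Ch. II §5] -/
theorem map_evalRingHom_sum_single_self (i : ι) (q : (R i)[X]) :
    (∑ n ∈ q.support, C (Pi.single i (q.coeff n) : Π k, R k) * X ^ n).map (Pi.evalRingHom R i) = q := by
  rw [Polynomial.map_sum]
  simp only [Polynomial.map_mul, map_C, Pi.evalRingHom_apply, Polynomial.map_pow, map_X, Pi.single_eq_same]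
  exact (as_sum_support_C_mul_X_pow q).symm

omit [Fintype ι] in
/-- … and all other components `0`. [cite: Lang2002, Ch. II §5] -/
theorem map_evalRingHom_sum_single_ne {i j : ι} (hij : i ≠ j) (q : (R i)[X]) :
    (∑ n ∈ q.support, C (Pi.single i (q.coeff n) : Π k, R k) * X ^ n).map (Pi.evalRingHom R j) = 0 := by
  rw [Polynomial.map_sum]
  simp only [Polynomial.map_mul, map_C, Pi.evalRingHom_apply, Polynomial.map_pow, map_X, Pi.single_eq_of_ne' hij, map_zero,
    zero_mul, Finset.sum_const_zero]

/-- **Componentwise separable ⇒ separable** over a finite product of commutative rings (Bézout coefficients assembled through the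
lifts `Σ_n C (single_i c_n) Xⁿ`). [cite: Lang2002, Ch. II §5] -/
theorem separable_of_forall_map_evalRingHom (p : (Π i, R i)[X])
    (h : ∀ i, (p.map (Pi.evalRingHom R i)).Separable) : p.Separable := by
  classical
  choose a b hab using fun i => (h i)
  -- lifts of the Bézout coefficients
  let lift : (i : ι) → (R i)[X] → (Π k, R k)[X] := fun i q => ∑ n ∈ q.support, C (Pi.single i (q.coeff n) : Π k, R k) * X ^ n
  have hcomp : ∀ (f : (i : ι) → (R i)[X]) (j : ι), (∑ i, lift i (f i)).map (Pi.evalRingHom R j) = f j := by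
    intro f j
    rw [Polynomial.map_sum, Finset.sum_eq_single j]
    · exact map_evalRingHom_sum_single_self j (f j)
    · intro i _ hij
      exact map_evalRingHom_sum_single_ne hij (f i)
    · intro hj; exact absurd (Finset.mem_univ j) hj
  refine ⟨∑ i, lift i (a i), ∑ i, lift i (b i), eq_of_forall_map_evalRingHom_eq fun j => ?_⟩
  rw [Polynomial.map_add, Polynomial.map_mul, Polynomial.map_mul, hcomp, hcomp, ← Polynomial.derivative_map, Polynomial.map_one]
  exact hab j

/-- **Separability over a finite product of commutative rings is componentwise.** [cite: Lang2002, Ch. II §5] -/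
theorem separable_iff_forall_map_evalRingHom (p : (Π i, R i)[X]) :
    p.Separable ↔ ∀ i, (p.map (Pi.evalRingHom R i)).Separable :=
  ⟨fun hp _ => hp.map, separable_of_forall_map_evalRingHom p⟩

end Literature.Algebra.Polynomial

end
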